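import Literature.AlgebraicGeometry.Motives.GrassmannianSheaf
import Literature.AlgebraicGeometry.Motives.GrassmannianChartTransition
import Literature.AlgebraicGeometry.Modules.MatrixCocycleFrame
import Literature.AlgebraicGeometry.Modules.RankOneCocycle
import Literature.AlgebraicGeometry.Modules.VanishingLocusFiniteLocallyFree
import Literature.AlgebraicGeometry.Modules.IsoOfAffineCover
import HarnessLib

/-!
# The rank-`k` quotient `π_x : 𝒪_T ⊗ M ↠ 𝒬_x` of a point `x ∈ Gr(T)` covered by charts

For a free abelian group `M` with basis `b : J → M`, a scheme `T` and a point `x ∈ Gr_k(M)(T)` of the Grassmannian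
sheaf (★ `Motives/GrassmannianSheaf`), **chart data** `D : ChartData b x ι` is an affine open cover `(U_a)` of `T` with
affine pairwise intersections and frames `b ∘ I_a`, `I_a : Fin k → J`, such that `x|_{U_a}` lies in the standard chart of
`b ∘ I_a` ([GortzWedhorn2020, (8.4) (pp. 213–215)], [StacksProject, Tag 089T]; for the universal point of
`grassmannianScheme M k` the chart immersions of ★ `GrassmannianSchemeCharts` are such data). From it we build, with no
choices:

* §1 `ChartData.cocycle` — the transition cocycle `g_{ac} ∈ GL_k(Γ(T, V))` (`V ≤ U_a ⊓ U_c`) of the frames, in the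
  convention of ★ `GrassmannianChartTransition` (`frameMap_c = frameMap_a ∘ g_{ac}`, `c_a(m) = g_{ac} c_c(m)`,
  `g_{ac} g_{cd} = g_{ad}`; the identities are checked on affine opens, ★ `transition_mul_transition`);
* §2 `ChartData.quotientModule` — **the quotient module `𝒬_x`** glued from the cocycle (★ `Modules/MatrixCocycleGluing`,
  [Hartshorne1977, II Ex. 5.18]) with its frames `quotientFrame a : 𝒪^k ≅ 𝒬_x|_{U_a}` (★ `MatrixCocycleFrame`);
  `hasRank_quotientModule : HasRank 𝒬_x k`;
* §3 `ChartData.quotientSection j ∈ Γ(𝒬_x, T)` — the global sections `q_j` glued from the frame coordinates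
  `c_a(1 ⊗ b_j)` (a glue family by `c_a = g_{ac} c_c`);
* §4 `map_quotientSection_eq_sum` — **the frame expansion `q_j|_V = ∑_i c_a(b_j)_i • t_{a,i}|_V`** on affine
  `V ≤ U_a` (the input `hq` of ★ `GrassmannianChartTautologicalQuotient` §2, which yields
  `ker (Γ(T, V) ⊗ M → Γ(𝒬_x, V)) = x|_V`), and **the quotient map `quotientπ : 𝒪_T^{(J)} ⟶ 𝒬_x`,
  `ε_j ↦ q_j`** (Mathlib `freeHomEquiv`), an EPIMORPHISM when the `U_a` cover `T` (`epi_quotientπ`: over `U_a` the column section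
  `t_{a,l}` is the image of `ε_{b(I_a l)}`, [Hartshorne1977, II Prop. 5.6]).

Everything is proved; no named facts. Not here: the instantiation at the universal point and the universal property
(every `f : T → Gr` is the classifying map of `f^*π`), which are the sequel files.

## References

* U. Görtz, T. Wedhorn, *Algebraic Geometry I*, 2nd ed. (2020), (8.4) pp. 213–215, Lemma 8.13. [GortzWedhorn2020]
* R. Hartshorne, *Algebraic Geometry*, GTM 52 (1977), II Ex. 5.18, II Prop. 5.6 (p. 113), II §5 (p. 109). [Hartshorne1977]
* The Stacks Project, Tag 089T (the Grassmannian is a scheme: standard charts). [StacksProject]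
-/

noncomputable section

-- Mathlib's `Scheme.Modules` section API (`presheaf.map`, `Hom.app`, `TopCat.Presheaf`) is stated across
-- semireducible wrappers; as in Mathlib's own `AlgebraicGeometry/Modules/Sheaf.lean`.
set_option backward.isDefEq.respectTransparency false

universe u

open CategoryTheory Opposite TensorProduct TopologicalSpace AlgebraicGeometry

namespace Literature.AlgebraicGeometry.Modules

/-- The free `𝒪_T`-module `𝒪_T^{(J)}` (Mathlib `SheafOfModules.free J`) as an object of `T.Modules`, so that morphisms out
of it are morphisms of `𝒪_T`-modules (`Scheme.Modules.Hom`, with `Hom.app`; cf. ★ `unitModule`).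
[cite: Hartshorne1977, II §5 (p. 109)] -/
abbrev freeModule (T : _root_.AlgebraicGeometry.Scheme.{u}) (J : Type u) : T.Modules :=
  SheafOfModules.free J

/-- The tautological basis section `ε_j|_V ∈ Γ(𝒪_T^{(J)}, V)` of the free module (Mathlib `SheafOfModules.freeSection`,
evaluated at `V`). [cite: Hartshorne1977, II §5 (p. 109)] -/
abbrev freeSectionOn (T : _root_.AlgebraicGeometry.Scheme.{u}) {J : Type u} (j : J) (V : T.Opens) : Γ(freeModule T J, V) :=
  (SheafOfModules.freeSection (R := T.ringCatSheaf) j).eval (op V)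

end Literature.AlgebraicGeometry.Modules

namespace Literature.AlgebraicGeometry.Motives.Grassmannian

open Literature.AlgebraicGeometry.Modules

variable {M : Type u} [AddCommGroup M] {k : ℕ} {J : Type u} (b : Module.Basis J ℤ M) {T : Scheme.{u}}
  (x : (grassmannianSheaf M k).obj.obj (op T))

/-- Two sections of `𝒪_T` over an open `V` that agree on every affine open `W ≤ V` are equal. [folklore] -/
private theorem section_ext_of_affine {V : T.Opens} (s t : Γ(T, V))
    (h : ∀ (W : T.Opens), IsAffineOpen W → ∀ (i : W ≤ V), secRes T i s = secRes T i t) : s = t := by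
  refine TopCat.Sheaf.eq_of_locally_eq' T.sheaf (fun W : {W : T.affineOpens // (W : T.Opens) ≤ V} => (W.1 : T.Opens))
    V (fun W => homOfLE W.2) ?_ s t fun W => h W.1.1 W.1.2 W.2
  intro y hy
  obtain ⟨W, hW, hyW, hWV⟩ := Opens.isBasis_iff_nbhd.mp T.isBasis_affineOpens hy
  exact Opens.mem_iSup.mpr ⟨⟨⟨W, hW⟩, hWV⟩, hyW⟩

/-! ## §1 Chart data of a point and its transition cocycle -/

/-- **Chart data for a point `x ∈ Gr(T)`**: affine opens `U_a ⊆ T` with affine pairwise intersections, and frames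
`b ∘ I_a` (`I_a : Fin k → J`) such that `x|_{U_a}` lies in the standard chart of the frame (its frame map is bijective).
For the universal point of `grassmannianScheme M k` the chart immersions of ★ `GrassmannianSchemeCharts` are such data.
[cite: StacksProject, Tag 089T] -/
structure ChartData (ι : Type u) where
  /-- The chart open `U_a`. -/
  U : ι → T.Opens
  /-- `U_a` is affine. -/
  isAffineOpen : ∀ a, IsAffineOpen (U a)
  /-- `U_a ⊓ U_c` is affine. -/
  isAffineOpen_inf : ∀ a c, IsAffineOpen (U a ⊓ U c)
  /-- The frame indices `I_a : Fin k → J` (frame `b ∘ I_a`). -/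
  frame : ι → Fin k → J
  /-- On `U_a` the point lies in the chart of the frame `b ∘ I_a`. -/
  mem_chart : ∀ a, evalAffine (isAffineOpen a) x ∈ chart ℤ M k (⇑b ∘ frame a) Γ(T, U a)

namespace ChartData

variable {b x} {ι : Type u} (D : ChartData b x ι)

/-- The value of the point on an affine open `W ≤ U_a` lies in the `a`-th chart. [cite: StacksProject, Tag 089T] -/
theorem evalAffine_mem_chart {a : ι} {W : T.Opens} (hW : IsAffineOpen W) (hle : W ≤ D.U a) :
    evalAffine hW x ∈ chart ℤ M k (⇑b ∘ D.frame a) Γ(T, W) := by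
  rw [evalAffine_of_le (D.isAffineOpen a) hW hle]
  exact map_mem_chart _ (D.mem_chart a)

/-- `coordMap` only depends on the point up to equality (the membership proof is irrelevant). [cite: StacksProject, Tag 089T] -/
theorem coordMap_congr {A : Type u} [CommRing A] {y : Fin k → M} {N N' : Module.Grassmannian A (A ⊗[ℤ] M) k}
    (e : N = N') (hN : N ∈ chart ℤ M k y A) (hN' : N' ∈ chart ℤ M k y A) (m : M) :
    coordMap y N hN m = coordMap y N' hN' m := by
  subst e
  rfl

/-- **The transition matrix over an affine open `W ≤ U_a`**: `g_{ac}(W) i j = coordMap (b ∘ I_a) N_W ((b ∘ I_c) j) i`,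
`N_W = x|_W` (★ `GrassmannianChartTransition` convention: `frameMap_c = frameMap_a ∘ g_{ac}`).
[cite: StacksProject, Tag 089T] -/
def transitionAt (a c : ι) {W : T.Opens} (hW : IsAffineOpen W) (ha : W ≤ D.U a) : Matrix (Fin k) (Fin k) Γ(T, W) :=
  Matrix.of fun i j => coordMap (⇑b ∘ D.frame a) (evalAffine hW x) (D.evalAffine_mem_chart hW ha) ((⇑b ∘ D.frame c) j) i

/-- Naturality of `transitionAt` under restriction to a smaller affine open (★ `transition_map`).
[cite: StacksProject, Tag 089T] -/
theorem transitionAt_map (a c : ι) {W W' : T.Opens} (hW : IsAffineOpen W) (hW' : IsAffineOpen W') (ha : W ≤ D.U a)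
    (i : W' ≤ W) :
    (D.transitionAt a c hW ha).map (secRes T i) = D.transitionAt a c hW' (i.trans ha) := by
  have h := transition_map (T.presheaf.map (homOfLE i).op).hom.toIntAlgHom (⇑b ∘ D.frame a) (⇑b ∘ D.frame c)
    (evalAffine hW x) (D.evalAffine_mem_chart hW ha)
  unfold transitionAt
  refine (h.symm.trans ?_)
  ext i' j
  simp only [Matrix.of_apply]
  exact congrFun (coordMap_congr (evalAffine_of_le hW hW' i x).symm _ _ _) i'

/-- The cocycle identity over an affine open (★ `transition_mul_transition`). [cite: StacksProject, Tag 089T] -/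
theorem transitionAt_mul (a c d : ι) {W : T.Opens} (hW : IsAffineOpen W) (ha : W ≤ D.U a) (hc : W ≤ D.U c) :
    D.transitionAt a c hW ha * D.transitionAt c d hW hc = D.transitionAt a d hW ha :=
  transition_mul_transition (⇑b ∘ D.frame a) (⇑b ∘ D.frame c) (⇑b ∘ D.frame d) _ _ _

/-- `g_{aa} = 1` over an affine open (★ `transition_self`). [cite: StacksProject, Tag 089T] -/
theorem transitionAt_self (a : ι) {W : T.Opens} (hW : IsAffineOpen W) (ha : W ≤ D.U a) :
    D.transitionAt a a hW ha = 1 :=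
  transition_self (⇑b ∘ D.frame a) _ _

/-- The transition matrix over an arbitrary open `V ≤ U_a ⊓ U_c` (restricted from the affine `U_a ⊓ U_c`), with indices
lifted to `Type u`. [cite: StacksProject, Tag 089T] -/
def transition (a c : ι) (V : T.Opens) (ha : V ≤ D.U a) (hc : V ≤ D.U c) :
    Matrix (ULift.{u} (Fin k)) (ULift.{u} (Fin k)) Γ(T, V) :=
  ((D.transitionAt a c (D.isAffineOpen_inf a c) inf_le_left).map (secRes T (le_inf ha hc))).submatrix
    (Equiv.ulift : ULift.{u} (Fin k) ≃ Fin k) Equiv.ulift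

/-- Over an affine `V ≤ U_a ⊓ U_c` the transition matrix is `transitionAt` (reindexed). [cite: StacksProject, Tag 089T] -/
theorem transition_eq_of_isAffineOpen (a c : ι) {V : T.Opens} (hV : IsAffineOpen V) (ha : V ≤ D.U a) (hc : V ≤ D.U c) :
    D.transition a c V ha hc =
      (D.transitionAt a c hV ha).submatrix (Equiv.ulift : ULift.{u} (Fin k) ≃ Fin k) Equiv.ulift := by
  unfold transition
  rw [D.transitionAt_map a c (D.isAffineOpen_inf a c) hV inf_le_left (le_inf ha hc)]

/-- Restriction of the transition matrix. [cite: StacksProject, Tag 089T] -/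
theorem transition_map (a c : ι) {V V' : T.Opens} (ha : V ≤ D.U a) (hc : V ≤ D.U c) (i : V' ≤ V) :
    (D.transition a c V ha hc).map (secRes T i) = D.transition a c V' (i.trans ha) (i.trans hc) := by
  unfold transition
  rw [← Matrix.submatrix_map, Matrix.map_map]
  congr 2
  funext s
  exact secRes_secRes _ _ s

/-- **The transition cocycle of the point `x` along the chart data** `D` (the cocycle identities hold over every affine
open and sections of `𝒪_T` are determined on affine opens).
[cite: StacksProject, Tag 089T] [cite: Hartshorne1977, II Ex. 5.18] -/
def cocycle : Modules.MatrixCocycle T ι where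
  U := D.U
  I := fun _ => ULift.{u} (Fin k)
  g := D.transition
  map_g a c V V' ha hc i := D.transition_map a c ha hc i
  g_mul a c d V ha hc hd := by
    ext i j
    refine section_ext_of_affine _ _ fun W hW iW => ?_
    have key : ∀ (a' c' : ι) (ha' : V ≤ D.U a') (hc' : V ≤ D.U c'),
        (D.transition a' c' V ha' hc').map (secRes T iW) =
          (D.transitionAt a' c' hW (iW.trans ha')).submatrix (Equiv.ulift : ULift.{u} (Fin k) ≃ Fin k)
            Equiv.ulift :=
      fun a' c' ha' hc' => by rw [D.transition_map, D.transition_eq_of_isAffineOpen a' c' hW]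
    calc secRes T iW ((D.transition a c V ha hc * D.transition c d V hc hd) i j)
        = ((D.transition a c V ha hc * D.transition c d V hc hd).map (secRes T iW)) i j := rfl
      _ = ((D.transition a c V ha hc).map (secRes T iW) * (D.transition c d V hc hd).map (secRes T iW)) i j := by
          rw [Matrix.map_mul]
      _ = ((D.transitionAt a c hW (iW.trans ha) * D.transitionAt c d hW (iW.trans hc)).submatrix
            (Equiv.ulift : ULift.{u} (Fin k) ≃ Fin k) Equiv.ulift) i j := by
          rw [key, key, Matrix.submatrix_mul_equiv]
      _ = ((D.transition a d V ha hd).map (secRes T iW)) i j := by rw [D.transitionAt_mul, key]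
      _ = secRes T iW (D.transition a d V ha hd i j) := rfl
  g_self a V ha := by
    unfold transition
    rw [D.transitionAt_self, Matrix.map_one _ (map_zero _) (map_one _), Matrix.submatrix_one_equiv]

/-- The opens of the cocycle are the chart opens. [cite: StacksProject, Tag 089T] -/
@[simp]
theorem cocycle_U : D.cocycle.U = D.U := rfl

/-- The transition matrices of the cocycle. [cite: StacksProject, Tag 089T] -/
theorem cocycle_g (a c : ι) (V : T.Opens) (ha : V ≤ D.U a) (hc : V ≤ D.U c) :
    D.cocycle.g a c V ha hc = D.transition a c V ha hc := rfl

/-! ## §2 The quotient module: finite locally free of rank `k` -/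

/-- **The quotient module of the point `x` glued from its chart data** (`Γ(𝒬_x, V)` = glue families of frame
coordinates, ★ `MatrixCocycle.glued`). [cite: Hartshorne1977, II Ex. 5.18] -/
abbrev quotientModule : T.Modules :=
  D.cocycle.glued

/-- The frame of the quotient module over the chart open `U_a` (★ `MatrixCocycle.frame`). [cite: Hartshorne1977, II Ex. 5.18] -/
abbrev quotientFrame (a : ι) : SheafOfModules.free (ULift.{u} (Fin k)) ≅ D.quotientModule.over (D.U a) :=
  D.cocycle.frame a

/-- **The quotient module has rank `k`** when the chart opens cover `T`. [cite: Hartshorne1977, II Ex. 5.18] -/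
theorem hasRank_quotientModule (hcov : ∀ t : T, ∃ a, t ∈ D.U a) : HasRank D.quotientModule k := by
  classical
  choose a ha using hcov
  exact FrameSystem.hasRank (E := D.quotientModule)
    { U := fun t => D.U (a t)
      mem := ha
      I := fun _ => ULift.{u} (Fin k)
      rank := fun _ => k
      enum := fun _ => Equiv.ulift
      frame := fun t => D.quotientFrame (a t) } k fun _ => rfl

/-! ## §3 The global sections `q_j`: frame coordinates of `1 ⊗ b_j` -/

/-- The frame coordinates of `1 ⊗ m` on an affine open `W ≤ U_a`:
`coordAt a W m = coordMap (b ∘ I_a) (x|_W) m ∈ Γ(T, W)ᵏ`.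
[cite: StacksProject, Tag 089T] -/
def coordAt (a : ι) {W : T.Opens} (hW : IsAffineOpen W) (ha : W ≤ D.U a) (m : M) : Fin k → Γ(T, W) :=
  coordMap (⇑b ∘ D.frame a) (evalAffine hW x) (D.evalAffine_mem_chart hW ha) m

/-- Frame coordinates restrict (★ `coordMap_map`). [cite: StacksProject, Tag 089T] -/
theorem secRes_coordAt (a : ι) {W W' : T.Opens} (hW : IsAffineOpen W) (hW' : IsAffineOpen W') (ha : W ≤ D.U a)
    (i : W' ≤ W) (m : M) (i' : Fin k) :
    secRes T i (D.coordAt a hW ha m i') = D.coordAt a hW' (i.trans ha) m i' := by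
  unfold coordAt
  rw [congrFun (coordMap_congr (evalAffine_of_le hW hW' i x) (D.evalAffine_mem_chart hW' (i.trans ha))
    (map_mem_chart _ (D.evalAffine_mem_chart hW ha)) m) i',
    coordMap_map (T.presheaf.map (homOfLE i).op).hom.toIntAlgHom (⇑b ∘ D.frame a) (evalAffine hW x)
      (D.evalAffine_mem_chart hW ha)]
  rfl

/-- Change of frame for the coordinates: `c_a(m) = g_{ac} *ᵥ c_c(m)` (★ `coordMap_eq_transition_mulVec`).
[cite: StacksProject, Tag 089T] -/
theorem coordAt_eq_transitionAt_mulVec (a c : ι) {W : T.Opens} (hW : IsAffineOpen W) (ha : W ≤ D.U a) (hc : W ≤ D.U c)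
    (m : M) : D.coordAt a hW ha m = (D.transitionAt a c hW ha).mulVec (D.coordAt c hW hc m) :=
  coordMap_eq_transition_mulVec (⇑b ∘ D.frame a) (⇑b ∘ D.frame c) _ _ _ m

/-- The family of frame coordinates of `1 ⊗ b_j` over the chart opens. [cite: StacksProject, Tag 089T] -/
def sectionFamily (j : J) (a : ι) (i : ULift.{u} (Fin k)) : Γ(T, ⊤ ⊓ D.U a) :=
  secRes T (inf_le_right : ⊤ ⊓ D.U a ≤ D.U a) (D.coordAt a (D.isAffineOpen a) le_rfl (b j) i.down)

/-- Restricted to an affine `W ≤ ⊤ ⊓ U_a`, the family is the frame coordinates over `W`. [cite: StacksProject, Tag 089T] -/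
theorem secRes_sectionFamily (j : J) (a : ι) {W : T.Opens} (hW : IsAffineOpen W) (i : W ≤ ⊤ ⊓ D.U a)
    (l : ULift.{u} (Fin k)) :
    secRes T i (D.sectionFamily j a l) = D.coordAt a hW (i.trans inf_le_right) (b j) l.down :=
  (secRes_secRes _ _ _).trans (D.secRes_coordAt a (D.isAffineOpen a) hW le_rfl _ (b j) l.down)

/-- **The frame coordinates of `1 ⊗ b_j` form a glue family** for the transition cocycle (`c_a = g_{ac} c_c`, checked on
affine opens). [cite: StacksProject, Tag 089T] [cite: Hartshorne1977, II Ex. 5.18] -/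
theorem isGlueFamily_sectionFamily (j : J) : D.cocycle.IsGlueFamily ⊤ (D.sectionFamily j) := by
  intro a c V' hV ha hc j'
  refine section_ext_of_affine _ _ fun W hW iW => ?_
  have hsec : ∀ (d : ι) (hd : V' ≤ D.cocycle.U d) (l : ULift.{u} (Fin k)),
      secRes T iW (secRes T (le_inf hV hd) (D.sectionFamily j d l)) = D.coordAt d hW (iW.trans hd) (b j) l.down :=
    fun d hd l => (secRes_secRes _ _ _).trans (D.secRes_sectionFamily j d hW _ l)
  have hl := hsec a ha j'
  -- the transition entries over `W`
  have hg : ∀ l : ULift.{u} (Fin k), secRes T iW (D.cocycle.g a c V' ha hc j' l) =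
      D.transitionAt a c hW (iW.trans ha) j'.down l.down := by
    intro l
    rw [cocycle_g, ← Matrix.map_apply (f := secRes T iW) (M := D.transition a c V' ha hc), D.transition_map,
      D.transition_eq_of_isAffineOpen a c hW]
    rfl
  have hr := hsec c hc
  rw [hl, map_sum]
  simp_rw [map_mul, hg, hr]
  rw [D.coordAt_eq_transitionAt_mulVec a c hW (iW.trans ha) (iW.trans hc) (b j)]
  simp only [Matrix.mulVec, dotProduct]
  exact (Equiv.sum_comp (Equiv.ulift : ULift.{u} (Fin k) ≃ Fin k)
    (fun l => D.transitionAt a c hW (iW.trans ha) j'.down l * D.coordAt c hW (iW.trans hc) (b j) l)).symm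

/-- **The global section `q_j ∈ Γ(𝒬_x, T)`**: the glue family of the frame coordinates of `1 ⊗ b_j`
(★ `MatrixCocycle.mkSection`).
[cite: Hartshorne1977, II Ex. 5.18] -/
def quotientSection (j : J) : Γ(D.quotientModule, ⊤) :=
  D.cocycle.mkSection ⊤ (D.sectionFamily j) (D.isGlueFamily_sectionFamily j)

/-- Components of `q_j`: the frame coordinates of `1 ⊗ b_j`. [cite: Hartshorne1977, II Ex. 5.18] -/
@[simp]
theorem comp_quotientSection (j : J) (a : ι) (i : ULift.{u} (Fin k)) :
    D.cocycle.comp (D.quotientSection j) a i = D.sectionFamily j a i :=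
  D.cocycle.comp_mkSection ⊤ (D.sectionFamily j) (D.isGlueFamily_sectionFamily j) a i

/-! ## §4 Frame expansions of the `q_j` and the quotient map `π_x : 𝒪_T^{(J)} → 𝒬_x` -/

/-- The restricted basis sections of the frame at `a` are the column sections `t_{a,i}` (★ `basisSection_frame`,
★ `map_gen`). [cite: Hartshorne1977, II Ex. 5.18] -/
theorem map_basisSection_quotientFrame (a : ι) {V : T.Opens} (ha : V ≤ D.U a) (i : ULift.{u} (Fin k)) :
    D.quotientModule.presheaf.map (homOfLE ha).op (basisSection (E := D.quotientModule) (D.quotientFrame a) i) =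
      D.cocycle.gen a i V ha :=
  (congrArg (fun s => D.cocycle.glued.presheaf.map (homOfLE ha).op s) (D.cocycle.basisSection_frame a i)).trans
    (D.cocycle.map_gen a i le_rfl (homOfLE ha))

/-- The frame vectors have standard coordinates: `c_a(b_{I_a l}) = e_l` (★ `coordMap_frame`). [cite: StacksProject, Tag 089T] -/
theorem coordAt_frame (a : ι) {W : T.Opens} (hW : IsAffineOpen W) (ha : W ≤ D.U a) (l i : Fin k) :
    D.coordAt a hW ha (b (D.frame a l)) i = (Pi.single l 1 : Fin k → Γ(T, W)) i :=
  congrFun (coordMap_frame (⇑b ∘ D.frame a) _ (D.evalAffine_mem_chart hW ha) l) i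

/-- The `a`-coordinates of `q_j|_V` over an affine `V ≤ U_a` are the frame coordinates `c_a(b_j)` over `V`.
[cite: StacksProject, Tag 089T] -/
theorem secRes_comp_map_quotientSection (j : J) (a : ι) {V : T.Opens} (hV : IsAffineOpen V) (ha : V ≤ D.U a)
    (i : ULift.{u} (Fin k)) :
    secRes T (le_inf le_rfl ha : V ≤ V ⊓ D.U a)
        (D.cocycle.comp (D.quotientModule.presheaf.map (homOfLE (le_top : V ≤ ⊤)).op (D.quotientSection j)) a i) =
      D.coordAt a hV ha (b j) i.down := by
  have e : D.cocycle.comp (D.quotientModule.presheaf.map (homOfLE (le_top : V ≤ ⊤)).op (D.quotientSection j)) a i =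
      secRes T (inf_le_inf_right (D.U a) (le_top : V ≤ ⊤)) (D.sectionFamily j a i) := rfl
  rw [e]
  exact (secRes_secRes _ _ _).trans (D.secRes_sectionFamily j a hV _ i)

/-- **Frame expansion `q_j|_V = ∑_i c_a(b_j)_i • t_{a,i}|_V` over an affine `V ≤ U_a`** — the hypothesis `hq` of
★ `GrassmannianChartTautologicalQuotient` §2 (`σ := Equiv.ulift`, `kV := homOfLE ha`, `e := quotientFrame a`): every
section is the combination of the column sections with its `a`-coordinates as coefficients (★ `eq_sum_smul_gen`).
[cite: GortzWedhorn2020, (8.4) (pp. 213–215)] [cite: Hartshorne1977, II Ex. 5.18] -/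
theorem map_quotientSection_eq_sum (j : J) (a : ι) {V : T.Opens} (hV : IsAffineOpen V) (ha : V ≤ D.U a) :
    D.quotientModule.presheaf.map (homOfLE (le_top : V ≤ ⊤)).op (D.quotientSection j) =
      ∑ i : ULift.{u} (Fin k), D.coordAt a hV ha (b j) i.down •
        D.quotientModule.presheaf.map (homOfLE ha).op (basisSection (E := D.quotientModule) (D.quotientFrame a) i) := by
  simp_rw [map_basisSection_quotientFrame]
  conv_lhs => rw [D.cocycle.eq_sum_smul_gen a V ha
    (D.quotientModule.presheaf.map (homOfLE (le_top : V ≤ ⊤)).op (D.quotientSection j))]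
  exact Finset.sum_congr rfl fun i _ =>
    congrArg (fun r => r • D.cocycle.gen a i V ha) (D.secRes_comp_map_quotientSection j a hV ha i)

/-- The global section `q_j` as a compatible family of sections over all opens (Mathlib `SheafOfModules.sections`).
[cite: Hartshorne1977, II Ex. 5.18] -/
def quotientSectionFamily (j : J) : D.quotientModule.sections :=
  PresheafOfModules.sectionsMk (M := D.quotientModule.val)
    (fun V => D.quotientModule.presheaf.map (homOfLE (le_top : V.unop ≤ ⊤)).op (D.quotientSection j))
    fun V V' i => by
      change (D.quotientModule.presheaf.map _ ≫ D.quotientModule.presheaf.map i) _ = _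
      rw [← Functor.map_comp]
      rfl

/-- **The quotient map `π_x : 𝒪_T^{(J)} → 𝒬_x`, `ε_j ↦ q_j`** (Mathlib `SheafOfModules.freeHomEquiv` on the families
`quotientSectionFamily`): the sheaf version of `Γ(T, V) ⊗ M → Γ(𝒬_x, V)`, `r ⊗ b_j ↦ r • q_j|_V`.
[cite: GortzWedhorn2020, (8.4) (pp. 213–215)] [cite: Hartshorne1977, II Ex. 5.18] -/
def quotientπ : freeModule T J ⟶ D.quotientModule :=
  D.quotientModule.freeHomEquiv.symm D.quotientSectionFamily

/-- `π_x` maps the restricted tautological basis section `ε_j|_V` to `q_j|_V`. [cite: Hartshorne1977, II Ex. 5.18] -/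
theorem quotientπ_app_freeSectionOn (j : J) (V : T.Opens) :
    D.quotientπ.app V (freeSectionOn T j V) =
      D.quotientModule.presheaf.map (homOfLE (le_top : V ≤ ⊤)).op (D.quotientSection j) :=
  congrArg (fun s : D.quotientModule.sections => s.eval (op V))
    (SheafOfModules.sectionsMap_freeHomEquiv_symm_freeSection (M := D.quotientModule) D.quotientSectionFamily j)

/-- **`π_x` is surjective on sections over every chart open `U_a`**: the column section `t_{a,l}` is the image of
`ε_{b(I_a l)}` (`c_a(b_{I_a l}) = e_l`), and every section over `U_a` is a combination of the `t_{a,l}` (★ `eq_sum_smul_gen`).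
[cite: GortzWedhorn2020, (8.4) (pp. 213–215)] [cite: Hartshorne1977, II Ex. 5.18] -/
theorem quotientπ_app_surjective (a : ι) : Function.Surjective (D.quotientπ.app (D.U a)) := by
  classical
  have hgen : ∀ l : ULift.{u} (Fin k),
      D.quotientπ.app (D.U a) (freeSectionOn T (D.frame a l.down) (D.U a)) = D.cocycle.gen a l (D.U a) le_rfl := fun l => by
    rw [quotientπ_app_freeSectionOn, D.map_quotientSection_eq_sum (D.frame a l.down) a (D.isAffineOpen a) le_rfl,
      Finset.sum_eq_single l, D.coordAt_frame, Pi.single_eq_same, one_smul, D.map_basisSection_quotientFrame]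
    · intro i _ hi
      rw [D.coordAt_frame, Pi.single_eq_of_ne (fun h : i.down = l.down => hi (Equiv.ulift.injective h)), zero_smul]
    · exact fun h => absurd (Finset.mem_univ l) h
  intro s
  refine ⟨∑ l, secRes T (le_inf le_rfl le_rfl : D.U a ≤ D.U a ⊓ D.U a) (D.cocycle.comp s a l) •
    freeSectionOn T (D.frame a l.down) (D.U a), ?_⟩
  rw [map_sum]
  simp_rw [Scheme.Modules.Hom.app_smul, hgen]
  exact (D.cocycle.eq_sum_smul_gen a (D.U a) le_rfl s).symm

/-- **`π_x : 𝒪_T^{(J)} → 𝒬_x` is an epimorphism** when the chart opens cover `T` (surjective over the affine cover `U_a`;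
the target is finite locally free, hence affine-localizing — ★ `epi_of_app_surjective_of_cover`).
[cite: GortzWedhorn2020, (8.4) (pp. 213–215)] [cite: Hartshorne1977, II Prop. 5.6 (p. 113)] -/
theorem epi_quotientπ (hcov : ∀ t : T, ∃ a, t ∈ D.U a) : Epi D.quotientπ :=
  epi_of_app_surjective_of_cover D.quotientπ
    (isAffineLocalizing_of_isFiniteLocallyFree (D.cocycle.isFiniteLocallyFree_glued hcov)) D.U D.isAffineOpen
    (top_le_iff.mp fun t _ => Opens.mem_iSup.mpr (hcov t)) D.quotientπ_app_surjective

end ChartData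

end Literature.AlgebraicGeometry.Motives.Grassmannian

end
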